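import Literature.NumberTheory.DiophantineApproximation.RhinViolaIntegrals
import Mathlib.MeasureTheory.Integral.IntervalIntegral.IntegrationByParts
import HarnessLib

/-!
# The Rhin–Viola involution `y ↦ x(1−y)/(x(1−y)+yz)` and the symmetry `I_z^{(0)}(h,j,k,l,m) = I_z^{(0)}(h,m,l,k,j)`

Topic `Literature/NumberTheory/DiophantineApproximation`. Everything here is PROVED (no definitions, no
named facts). Source: G. Rhin, C. Viola, *The permutation group method for the dilogarithm*, Ann. Sc.
Norm. Super. Pisa Cl. Sci. (5) 4 (2005) 389–437, (2.5)–(2.7): for `x ≠ 0, z` the involution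
`λ : y ↦ Y = x(1−y)/(x(1−y)+yz)` satisfies `dY/(x(1−Y)+Yz) = −dy/(x(1−y)+yz)`, maps `[0,1]` onto `[0,1]`
for `x > 0`, and, "owing to the normalization factor `z^{−l−m}`", transforms the integrals (2.1)–(2.3) into
themselves with the parameters permuted by `(j m)(k l)`:

  `I_z^{(ν)}(h, j, k, l, m) = I_z^{(ν)}(h, m, l, k, j)`   (2.6),   `I_z(h,j,k,l,m) = I_z(h,m,l,k,j)`   (2.7).

We prove (2.6) for the real member `ν = 0` (`RhinViola.I0` of `RhinViolaIntegrals.lean`), for `z ≥ 1`: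
the pointwise identity `integrand(h,m,l,k,j)(x, Y) · xz/D² = z^{j+k−l−m} · integrand(h,j,k,l,m)(x, y)`
(`D = x(1−y)+yz`, using `1 − Y = yz/D`, `x(1−Y)+Yz = xz/D`), the substitution in the inner integral for
each `x ∈ (0,1]` (`intervalIntegral.integral_comp_mul_deriv'`), and Fubini on the square. This is the
symmetry used in the proof of Theorem 2.1 of the paper to pass from the case `km > 0` to `jl > 0` and from
Lemma 2.4 to Lemma 2.5.

## References

* G. Rhin, C. Viola, Ann. Sc. Norm. Super. Pisa Cl. Sci. (5) 4 (2005) 389–437, (2.5)–(2.7). [RhinViola2005]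
-/

noncomputable section

namespace Literature.NumberTheory.DiophantineApproximation

namespace RhinViola

open _root_.MeasureTheory _root_.Set intervalIntegral
open ViolaZudilin (unitSquare denom₁ mem_unitSquare measurableSet_unitSquare volume_restrict_unitSquare)

/-! ### The involution `λ_{x,z}` -/

/-- For `x > 0`, `z ≥ x` and `y ∈ [0,1]`: `x(1−y) + yz ≥ x > 0`. [folklore] -/
theorem denom_pos_of_mem_Icc {x z y : ℝ} (hx : 0 < x) (hxz : x ≤ z) (hy : y ∈ Icc (0 : ℝ) 1) :
    0 < x * (1 - y) + y * z := by
  nlinarith [hy.1, hy.2, mul_nonneg hy.1 (sub_nonneg.2 hxz)]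

/-- `1 − Y = yz/D` for `Y = x(1−y)/D`, `D = x(1−y)+yz ≠ 0`. [cite: RhinViola2005, (2.5)] -/
theorem one_sub_lam {x z y : ℝ} (hD : x * (1 - y) + y * z ≠ 0) :
    1 - x * (1 - y) / (x * (1 - y) + y * z) = y * z / (x * (1 - y) + y * z) := by
  field_simp
  ring

/-- `x(1−Y) + Yz = xz/D` for `Y = x(1−y)/D`, `D = x(1−y)+yz ≠ 0`. [cite: RhinViola2005, (2.5)] -/
theorem denom_lam {x z y : ℝ} (hD : x * (1 - y) + y * z ≠ 0) :
    x * (1 - x * (1 - y) / (x * (1 - y) + y * z)) + x * (1 - y) / (x * (1 - y) + y * z) * z =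
      x * z / (x * (1 - y) + y * z) := by
  field_simp
  ring

/-- The derivative of the involution: `dY/dy = −xz/D²`. [cite: RhinViola2005, (2.5)] -/
theorem hasDerivAt_lam {x z y : ℝ} (hD : x * (1 - y) + y * z ≠ 0) :
    HasDerivAt (fun y : ℝ => x * (1 - y) / (x * (1 - y) + y * z))
      (-(x * z) / (x * (1 - y) + y * z) ^ 2) y := by
  have hnum : HasDerivAt (fun y : ℝ => x * (1 - y)) (x * (0 - 1)) y :=
    ((hasDerivAt_id y).const_sub 1).const_mul x |>.congr_deriv (by simp)
  have hden : HasDerivAt (fun y : ℝ => x * (1 - y) + y * z) (x * (0 - 1) + 1 * z) y := by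
    have h1 : HasDerivAt (fun y : ℝ => x * (1 - y)) (x * (0 - 1)) y :=
      ((hasDerivAt_id y).const_sub 1).const_mul x |>.congr_deriv (by simp)
    exact h1.add ((hasDerivAt_id y).mul_const z)
  refine (hnum.div hden hD).congr_deriv ?_
  field_simp
  ring

/-- For `x > 0`, `z ≥ x`, the involution maps `[0,1]` into `[0,1]`. [cite: RhinViola2005, (2.5)] -/
theorem lam_mem_Icc {x z y : ℝ} (hx : 0 < x) (hxz : x ≤ z) (hy : y ∈ Icc (0 : ℝ) 1) :
    x * (1 - y) / (x * (1 - y) + y * z) ∈ Icc (0 : ℝ) 1 := by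
  have hD := denom_pos_of_mem_Icc hx hxz hy
  refine ⟨div_nonneg (mul_nonneg hx.le (by linarith [hy.2])) hD.le, ?_⟩
  rw [div_le_one hD]
  nlinarith [hy.1, mul_nonneg hy.1 (hx.le.trans hxz)]

/-! ### The pointwise transformation of the integrand -/

/-- **The integrand under `λ`**: for `D = x(1−y)+yz ≠ 0`, `x, z ≠ 0`,
`integrand(h,m,l,k,j)(x, Y) · (xz/D²) = z^{j+k}/z^{l+m} · integrand(h,j,k,l,m)(x, y)`, `Y = x(1−y)/D`
(from `Y = x(1−y)/D`, `1−Y = yz/D`, `x(1−Y)+Yz = xz/D`). [cite: RhinViola2005, (2.5)–(2.6)] -/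
theorem integrand_lam_mul {x z y : ℝ} (hx : x ≠ 0) (hz : z ≠ 0) (hD : x * (1 - y) + y * z ≠ 0)
    (h j k l m : ℕ) :
    integrand z h m l k j (x, x * (1 - y) / (x * (1 - y) + y * z)) * (x * z / (x * (1 - y) + y * z) ^ 2) =
      z ^ (j + k) / z ^ (l + m) * integrand z h j k l m (x, y) := by
  simp only [integrand, denom₁]
  rw [denom_lam hD, one_sub_lam hD]
  -- the identity holds with `D = x(1−y)+yz` as an independent non-zero quantity
  generalize x * (1 - y) + y * z = D at hD ⊢
  simp only [div_pow, mul_pow]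
  field_simp
  ring

/-! ### The inner integral -/

/-- Continuity of `Y ↦ integrand(h,m,l,k,j)(x, Y)` on `[0,1]` for `0 < x ≤ z` (the denominator is
`≥ x > 0` there). [folklore] -/
theorem continuousOn_integrand_section {x z : ℝ} (hx : 0 < x) (hxz : x ≤ z) (h j k l m : ℕ) :
    ContinuousOn (fun Y : ℝ => integrand z h m l k j (x, Y)) (Icc (0 : ℝ) 1) := by
  simp only [integrand, denom₁]
  refine ContinuousOn.div (by fun_prop) (by fun_prop) fun Y hY => ?_
  exact pow_ne_zero _ (denom_pos_of_mem_Icc hx hxz hY).ne'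

/-- **The inner integral under `λ`** (`0 < x ≤ 1 ≤ z`):
`∫₀¹ integrand(h,m,l,k,j)(x,Y) dY = z^{j+k}/z^{l+m} ∫₀¹ integrand(h,j,k,l,m)(x,y) dy` — the substitution
`Y = x(1−y)/(x(1−y)+yz)`, `Y(0) = 1`, `Y(1) = 0`, `dY = −xz dy/D²`. [cite: RhinViola2005, (2.5)–(2.6)] -/
theorem integral_section_lam {x z : ℝ} (hx : 0 < x) (hx1 : x ≤ 1) (hz : 1 ≤ z) (h j k l m : ℕ) :
    ∫ Y in (0 : ℝ)..1, integrand z h m l k j (x, Y) =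
      z ^ (j + k) / z ^ (l + m) * ∫ y in (0 : ℝ)..1, integrand z h j k l m (x, y) := by
  have hxz : x ≤ z := hx1.trans hz
  have hz0 : z ≠ 0 := by positivity
  set f : ℝ → ℝ := fun y => x * (1 - y) / (x * (1 - y) + y * z) with hf
  set f' : ℝ → ℝ := fun y => -(x * z) / (x * (1 - y) + y * z) ^ 2 with hf'
  have hD : ∀ y ∈ uIcc (0 : ℝ) 1, x * (1 - y) + y * z ≠ 0 := fun y hy =>
    (denom_pos_of_mem_Icc hx hxz (by rwa [uIcc_of_le zero_le_one] at hy)).ne'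
  have hderiv : ∀ y ∈ uIcc (0 : ℝ) 1, HasDerivAt f (f' y) y := fun y hy => hasDerivAt_lam (hD y hy)
  have hcont' : ContinuousOn f' (uIcc (0 : ℝ) 1) := by
    simp only [hf']
    exact ContinuousOn.div continuousOn_const (by fun_prop) fun y hy => pow_ne_zero _ (hD y hy)
  have himage : f '' uIcc (0 : ℝ) 1 ⊆ Icc 0 1 := by
    rintro _ ⟨y, hy, rfl⟩
    rw [uIcc_of_le zero_le_one] at hy
    exact lam_mem_Icc hx hxz hy
  have hg : ContinuousOn (fun Y : ℝ => integrand z h m l k j (x, Y)) (f '' uIcc (0 : ℝ) 1) :=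
    (continuousOn_integrand_section hx hxz h j k l m).mono himage
  have hsub := integral_comp_mul_deriv' hderiv hcont' hg
  -- `f 0 = 1`, `f 1 = 0`
  have hf0 : f 0 = 1 := by simp [hf, hx.ne']
  have hf1 : f 1 = 0 := by simp [hf]
  rw [hf0, hf1, integral_symm (0 : ℝ) 1] at hsub
  -- the left side of the substitution formula is `-(z^{j+k}/z^{l+m}) ∫ integrand(h,j,k,l,m)`
  have hlhs : ∫ y in (0 : ℝ)..1, ((fun Y : ℝ => integrand z h m l k j (x, Y)) ∘ f) y * f' y =
      -(z ^ (j + k) / z ^ (l + m) * ∫ y in (0 : ℝ)..1, integrand z h j k l m (x, y)) := by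
    rw [← intervalIntegral.integral_const_mul, ← intervalIntegral.integral_neg]
    refine integral_congr fun y hy => ?_
    simp only [Function.comp_apply, hf, hf']
    have hDy := hD y hy
    have key := integrand_lam_mul hx.ne' hz0 hDy h j k l m
    rw [neg_div, mul_neg, key]
  rw [hlhs] at hsub
  linarith

/-! ### The symmetry of `I_z^{(0)}` -/

/-- **Rhin–Viola (2.6), real member**: `I_z^{(0)}(h, j, k, l, m) = I_z^{(0)}(h, m, l, k, j)` for `z ≥ 1`
(the involution `λ_{x,z}` in the inner integral, for almost every `x`, and Fubini; the factor
`z^{j+k−l−m}` is absorbed by the normalisations `z^{−l−m}`, `z^{−k−j}`). [cite: RhinViola2005, (2.6)] -/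
theorem I0_lam {z : ℝ} (hz : 1 ≤ z) (h j k l m : ℕ) : I0 z h m l k j = I0 z h j k l m := by
  have hz0 : z ≠ 0 := by positivity
  -- Fubini for both parameter tuples
  have hF : ∀ a b c d e : ℕ, ∫ p in unitSquare, integrand z a b c d e p =
      ∫ x in Icc (0 : ℝ) 1, ∫ y in Icc (0 : ℝ) 1, integrand z a b c d e (x, y) := by
    intro a b c d e
    have hint : Integrable (integrand z a b c d e)
        (((volume : Measure ℝ).restrict (Icc 0 1)).prod ((volume : Measure ℝ).restrict (Icc 0 1))) := by
      have h' := integrableOn_integrand hz a b c d e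
      rwa [IntegrableOn, volume_restrict_unitSquare] at h'
    rw [show (∫ p in unitSquare, integrand z a b c d e p) = ∫ p, integrand z a b c d e p
        ∂((volume : Measure ℝ).restrict (Icc 0 1)).prod ((volume : Measure ℝ).restrict (Icc 0 1)) by
      rw [← volume_restrict_unitSquare]]
    exact integral_prod _ hint
  -- the inner integrals agree up to the factor `z^{j+k}/z^{l+m}` for `x ∈ (0,1]`
  have hinner : EqOn (fun x : ℝ => ∫ y in Icc (0 : ℝ) 1, integrand z h m l k j (x, y))
      (fun x => z ^ (j + k) / z ^ (l + m) * ∫ y in Icc (0 : ℝ) 1, integrand z h j k l m (x, y))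
      (Ioc (0 : ℝ) 1) := by
    intro x hx
    simp only
    rw [integral_Icc_eq_integral_Ioc, ← integral_of_le zero_le_one, integral_Icc_eq_integral_Ioc,
      ← integral_of_le zero_le_one]
    exact integral_section_lam hx.1 hx.2 hz h j k l m
  have e1 : z ^ (-((k : ℤ) + j)) = (z ^ (j + k))⁻¹ := by
    rw [show -((k : ℤ) + j) = -((j + k : ℕ) : ℤ) by push_cast; ring, zpow_neg, zpow_natCast]
  have e2 : z ^ (-((l : ℤ) + m)) = (z ^ (l + m))⁻¹ := by
    rw [show -((l : ℤ) + m) = -((l + m : ℕ) : ℤ) by push_cast; ring, zpow_neg, zpow_natCast]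
  simp only [I0]
  rw [hF, hF, integral_Icc_eq_integral_Ioc, integral_Icc_eq_integral_Ioc (f := fun x => ∫ y in Icc 0 1, _),
    setIntegral_congr_fun measurableSet_Ioc hinner, MeasureTheory.integral_const_mul, e1, e2]
  field_simp

end RhinViola

end Literature.NumberTheory.DiophantineApproximation

end
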